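import Mathlib
import HarnessLib
import Summits.HubbardSuperconductivity.HubbardSuperconductivity.Theorems.ThermalWedgeTwPureThermalBoundDensityLimitA

/-!
# Route `ThermalWedge`, item `stmt-HubbardSuperconductivity-1702` (`TwPureThermalBound`):
# the abstract real analysis of the thermodynamic limit of sector energies — part B (existence, Lipschitz)

Support file (`--supports stmt-HubbardSuperconductivity-1702`; pure real analysis, no definition). For an
abstract family of sector energies `E : ℕ → ℕ → ℝ` (`E L K`: side `L`, particle number `K`) obeying the
finite-volume estimates that the tree proves for the Hubbard tori (`HubbardTorus2DTiling`,
`HubbardOneParticleCost`, `ThermalWedgeTwPureThermalBoundSectorLipschitz`) —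
(zero) `E L 0 = 0`, (low) `−c L² ≤ E L K`, (up) `E L (K+1) ≤ E L K + C` for `2(K+1) ≤ 3L²`,
(down) `E L (K−1) ≤ E L K + C`, (tile) `E ((k+1)M) (Σ N_ij) ≤ Σ E M N_ij + T M k (k+1)`,
(fill) `E (ℓ+r) (N + N_B) ≤ E ℓ N + F((rℓ + r(ℓ+r)) + (2ℓ + r))` —
the sector energies at density `ν ∈ [0, 5/4]`, `a_ν(L) = E L ⌊νL²⌋`, satisfy the hypotheses of the Fekete
lemma of part A (`ptb_tendsto_density_of_tiling`) with tiling constant `A = 2C + T` and filling constant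
`B = F`, so `E L ⌊νL²⌋ / L²` converges, to the explicit value
`e(ν) = inf_{M ≥ 2} (E M ⌊νM²⌋/M² + (2C+T)/M)` (`ptb_tendsto_sectorDensity`); moreover `e(0) = 0` and `e` is
`C`-Lipschitz on `[0, 5/4]` (`ptb_abs_eLim_sub_le`). Folklore (Ruelle, *Statistical Mechanics* (1969) §3).
-/

set_option linter.dupNamespace false

noncomputable section

namespace Summit.HubbardSuperconductivity.HubbardSuperconductivity.Theorems

open Filter Set Finset
open scoped Topology BigOperators

section Abstract

variable {E : ℕ → ℕ → ℝ} {c C T F : ℝ}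

/-! ### Chains of one-particle steps -/

/-- Adding `j` particles below density `3/2`: `E L (K + j) ≤ E L K + C j` if `2(K + j) ≤ 3L²`. [folklore] -/
theorem ptb_E_add_le (hup : ∀ L K : ℕ, 2 * (K + 1) ≤ 3 * L ^ 2 → E L (K + 1) ≤ E L K + C)
    (L K j : ℕ) (hj : 2 * (K + j) ≤ 3 * L ^ 2) : E L (K + j) ≤ E L K + C * j := by
  induction j with
  | zero => simp
  | succ j ih =>
      have h1 := ih (by omega)
      have h2 := hup L (K + j) (by omega)
      rw [← add_assoc]
      push_cast
      linarith

/-- Removing `j` particles: `E L (K − j) ≤ E L K + C j` for `j ≤ K ≤ 2L²`. [folklore] -/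
theorem ptb_E_sub_le (hdn : ∀ L K : ℕ, 1 ≤ K → K ≤ 2 * L ^ 2 → E L (K - 1) ≤ E L K + C)
    (L K j : ℕ) (hK : K ≤ 2 * L ^ 2) (hj : j ≤ K) : E L (K - j) ≤ E L K + C * j := by
  induction j with
  | zero => simp
  | succ j ih =>
      have h1 := ih (by omega)
      have h2 := hdn L (K - j) (by omega) (by omega)
      rw [show K - j - 1 = K - (j + 1) by omega] at h2
      push_cast
      linarith

/-- **Two-sided Lipschitz bound below density `3/2`**: `|E L K − E L K'| ≤ C|K − K'|` for
`2K, 2K' ≤ 3L²` (with `K, K' ≤ 2L²`). [folklore] -/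
theorem ptb_abs_E_sub_E_le (hup : ∀ L K : ℕ, 2 * (K + 1) ≤ 3 * L ^ 2 → E L (K + 1) ≤ E L K + C)
    (hdn : ∀ L K : ℕ, 1 ≤ K → K ≤ 2 * L ^ 2 → E L (K - 1) ≤ E L K + C)
    (L K K' : ℕ) (hK : 2 * K ≤ 3 * L ^ 2) (hK' : 2 * K' ≤ 3 * L ^ 2) :
    |E L K - E L K'| ≤ C * |((K : ℝ) - K')| := by
  wlog hle : K' ≤ K generalizing K K'
  · have h := this K' K hK' hK (le_of_not_ge hle)
    rwa [abs_sub_comm, abs_sub_comm (K' : ℝ)] at h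
  obtain ⟨j, rfl⟩ := Nat.exists_eq_add_of_le hle
  have hup' := ptb_E_add_le hup L K' j hK
  have hdn' := ptb_E_sub_le hdn L (K' + j) j (by omega) (by omega)
  rw [Nat.add_sub_cancel] at hdn'
  have hj : |(((K' + j : ℕ) : ℝ)) - K'| = j := by push_cast; rw [add_sub_cancel_left, Nat.abs_cast]
  rw [hj, abs_le]
  constructor <;> linarith

/-! ### Floors of densities -/

/-- `⌊νL²⌋ ≤ νL²` and `2⌊νL²⌋ + 2 ≤ 3L²` for `ν ≤ 5/4`, `L ≥ 2` (room for one more particle below density `3/2`).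
[folklore] -/
theorem ptb_two_floor_succ_le {ν : ℝ} (hν0 : 0 ≤ ν) (hν : ν ≤ 5 / 4) {L : ℕ} (hL : 2 ≤ L) :
    2 * (⌊ν * (L : ℝ) ^ 2⌋₊ + 1) ≤ 3 * L ^ 2 := by
  have hfl : (⌊ν * (L : ℝ) ^ 2⌋₊ : ℝ) ≤ ν * (L : ℝ) ^ 2 := Nat.floor_le (by positivity)
  have hL' : (2 : ℝ) ≤ L := by exact_mod_cast hL
  have hL2 : (4 : ℝ) ≤ (L : ℝ) ^ 2 := by nlinarith
  have key : (2 * (⌊ν * (L : ℝ) ^ 2⌋₊ + 1) : ℝ) ≤ 3 * (L : ℝ) ^ 2 := by nlinarith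
  exact_mod_cast key

/-- `⌊νL²⌋ ≤ 2L²` for `ν ≤ 5/4`. [folklore] -/
theorem ptb_floor_le_two_mul_sq {ν : ℝ} (hν0 : 0 ≤ ν) (hν : ν ≤ 5 / 4) (L : ℕ) :
    ⌊ν * (L : ℝ) ^ 2⌋₊ ≤ 2 * L ^ 2 := by
  have hfl : (⌊ν * (L : ℝ) ^ 2⌋₊ : ℝ) ≤ ν * (L : ℝ) ^ 2 := Nat.floor_le (by positivity)
  have : (⌊ν * (L : ℝ) ^ 2⌋₊ : ℝ) ≤ 2 * (L : ℝ) ^ 2 := by nlinarith [sq_nonneg (L : ℝ)]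
  exact_mod_cast this

/-! ### The tiling and filling inequalities for `a_ν(L) = E L ⌊νL²⌋` -/

/-- **Tiling in the form of part A**: for `ν ∈ [0, 5/4]`, `m ≥ 1`, `M ≥ 2`,
`a_ν(mM) ≤ m² a_ν(M) + (2C + T) m² M`: all `m²` blocks carry `⌊νM²⌋ + 1` particles (one more than the
block density, cost `C` each by (up)), and the surplus `≤ m²` particles of the assembled torus are removed
at cost `C` each by (down). [folklore] -/
theorem ptb_sectorDensity_tile (hC : 0 ≤ C) (hT : 0 ≤ T)
    (hup : ∀ L K : ℕ, 2 * (K + 1) ≤ 3 * L ^ 2 → E L (K + 1) ≤ E L K + C)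
    (hdn : ∀ L K : ℕ, 1 ≤ K → K ≤ 2 * L ^ 2 → E L (K - 1) ≤ E L K + C)
    (htile : ∀ (M k : ℕ) (Ns : Fin (k + 1) → Fin (k + 1) → ℕ), (∀ i j, Ns i j ≤ 2 * (M * M)) →
      E ((k + 1) * M) (∑ i, ∑ j, Ns i j) ≤ ∑ i, ∑ j, E M (Ns i j) + T * M * k * (k + 1))
    {ν : ℝ} (hν0 : 0 ≤ ν) (hν : ν ≤ 5 / 4) (m M : ℕ) (hm : 1 ≤ m) (hM : 2 ≤ M) :
    E (m * M) ⌊ν * (((m * M : ℕ) : ℝ)) ^ 2⌋₊ ≤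
      (m : ℝ) ^ 2 * E M ⌊ν * (M : ℝ) ^ 2⌋₊ + (2 * C + T) * ((m : ℝ) ^ 2 * M) := by
  obtain ⟨k, rfl⟩ : ∃ k, m = k + 1 := ⟨m - 1, (Nat.sub_add_cancel hm).symm⟩
  set q : ℕ := ⌊ν * (M : ℝ) ^ 2⌋₊ with hq
  set Tgt : ℕ := ⌊ν * ((((k + 1) * M : ℕ) : ℝ)) ^ 2⌋₊ with hTgt
  have hMpos : (0 : ℝ) < M := by exact_mod_cast lt_of_lt_of_le zero_lt_two hM
  have hq1 : q + 1 ≤ 2 * (M * M) := by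
    have h := ptb_two_floor_succ_le hν0 hν hM
    rw [← hq] at h
    nlinarith
  -- the uniform tiling with `q + 1` particles per block
  have ht := htile M k (fun _ _ => q + 1) (fun _ _ => hq1)
  simp only [Finset.sum_const, Finset.card_univ, Fintype.card_fin, smul_eq_mul, nsmul_eq_mul] at ht
  -- `Tgt ≤ (k+1)²(q+1)` and the surplus is `≤ (k+1)²`
  have hνM : ν * (M : ℝ) ^ 2 < q + 1 := Nat.lt_floor_add_one _
  have hTgt_le : Tgt ≤ (k + 1) * ((k + 1) * (q + 1)) := by
    have h1 : (Tgt : ℝ) ≤ ν * ((((k + 1) * M : ℕ) : ℝ)) ^ 2 := Nat.floor_le (by positivity)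
    have h2 : ν * ((((k + 1) * M : ℕ) : ℝ)) ^ 2 < (((k + 1) * ((k + 1) * (q + 1)) : ℕ) : ℝ) := by
      push_cast
      have : ν * (((k : ℝ) + 1) * M) ^ 2 = ((k : ℝ) + 1) ^ 2 * (ν * (M : ℝ) ^ 2) := by ring
      rw [this]
      have hk : (0 : ℝ) < ((k : ℝ) + 1) ^ 2 := by positivity
      nlinarith
    exact_mod_cast (h1.trans_lt h2).le
  have hTgt_ge : (k + 1) * ((k + 1) * q) ≤ Tgt := by
    refine Nat.le_floor ?_
    push_cast
    have hqle : (q : ℝ) ≤ ν * (M : ℝ) ^ 2 := Nat.floor_le (by positivity)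
    have : ν * (((k : ℝ) + 1) * M) ^ 2 = ((k : ℝ) + 1) ^ 2 * (ν * (M : ℝ) ^ 2) := by ring
    rw [this]
    have hk : (0 : ℝ) ≤ ((k : ℝ) + 1) ^ 2 := by positivity
    nlinarith
  -- remove the surplus
  have hbig : (k + 1) * ((k + 1) * (q + 1)) ≤ 2 * ((k + 1) * M) ^ 2 := by nlinarith
  set X : ℕ := (k + 1) * ((k + 1) * (q + 1)) - Tgt with hX
  have hXle : X ≤ (k + 1) * (k + 1) := by
    have hexp : (k + 1) * ((k + 1) * (q + 1)) = (k + 1) * ((k + 1) * q) + (k + 1) * (k + 1) := by ring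
    rw [hX]; omega
  have hdown := ptb_E_sub_le hdn ((k + 1) * M) ((k + 1) * ((k + 1) * (q + 1))) X hbig (Nat.sub_le _ _)
  rw [show (k + 1) * ((k + 1) * (q + 1)) - X = Tgt by omega] at hdown
  -- each block: `E M (q+1) ≤ E M q + C`
  have hblock := hup M q (ptb_two_floor_succ_le hν0 hν hM)
  -- assemble
  have hkM : (1 : ℝ) ≤ M := by exact_mod_cast (le_trans one_le_two hM)
  have hXr : (X : ℝ) ≤ ((k : ℝ) + 1) * ((k : ℝ) + 1) := by exact_mod_cast hXle
  push_cast at ht hdown ⊢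
  have h1 : ((k : ℝ) + 1) * (((k : ℝ) + 1) * E M (q + 1)) ≤ ((k : ℝ) + 1) ^ 2 * (E M q + C) := by
    have hk : (0 : ℝ) ≤ ((k : ℝ) + 1) ^ 2 := by positivity
    nlinarith
  have h2 : T * M * k * (k + 1) ≤ T * (((k : ℝ) + 1) ^ 2 * M) := by
    have : (k : ℝ) * (k + 1) ≤ ((k : ℝ) + 1) ^ 2 := by nlinarith
    have hTM : 0 ≤ T * M := by positivity
    nlinarith
  have h3 : C * (X : ℝ) ≤ C * (((k : ℝ) + 1) ^ 2 * M) := by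
    apply mul_le_mul_of_nonneg_left _ hC
    nlinarith
  have h4 : C * ((k : ℝ) + 1) ^ 2 ≤ C * (((k : ℝ) + 1) ^ 2 * M) := by
    apply mul_le_mul_of_nonneg_left _ hC
    have hk : (0 : ℝ) ≤ ((k : ℝ) + 1) ^ 2 := by positivity
    nlinarith
  linarith

/-- **Filling in the form of part A**: for `ν ∈ [0, 5/4]`, `k ≥ 1`, `r < M`, `1 ≤ M`:
`a_ν(kM + r) ≤ a_ν(kM) + F (kM + r)(2M + 3)` (the `⌊νL²⌋ − ⌊νℓ²⌋ ≤ 2(rℓ + rL)` extra particles go into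
the complement). [folklore] -/
theorem ptb_sectorDensity_fill (hF : 0 ≤ F)
    (hfill : ∀ (ℓ r N NB : ℕ), N ≤ 2 * (ℓ * ℓ) → NB ≤ 2 * (r * ℓ + r * (ℓ + r)) →
      E (ℓ + r) (N + NB) ≤ E ℓ N + F * ((r * ℓ + r * (ℓ + r) : ℕ) + (2 * ℓ + r : ℕ)))
    {ν : ℝ} (hν0 : 0 ≤ ν) (hν : ν ≤ 5 / 4) (k M r : ℕ) (hk : 1 ≤ k) (hM : 1 ≤ M) (hr : r < M) :
    E (k * M + r) ⌊ν * (((k * M + r : ℕ) : ℝ)) ^ 2⌋₊ ≤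
      E (k * M) ⌊ν * (((k * M : ℕ) : ℝ)) ^ 2⌋₊ + F * ((((k * M + r : ℕ) : ℝ)) * (2 * M + 3)) := by
  set ℓ : ℕ := k * M with hℓ
  set L : ℕ := ℓ + r with hLdef
  set N : ℕ := ⌊ν * (ℓ : ℝ) ^ 2⌋₊ with hN
  set P : ℕ := ⌊ν * (L : ℝ) ^ 2⌋₊ with hP
  have hℓ1 : 1 ≤ ℓ := Nat.mul_pos (by omega) (by omega)
  have hℓL : ℓ ≤ L := Nat.le_add_right _ _
  have hNP : N ≤ P := Nat.floor_le_floor (by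
    apply mul_le_mul_of_nonneg_left _ hν0
    exact pow_le_pow_left₀ (Nat.cast_nonneg _) (by exact_mod_cast hℓL) 2)
  have hN2 : N ≤ 2 * (ℓ * ℓ) := by
    have h := ptb_floor_le_two_mul_sq hν0 hν ℓ
    rw [← hN, sq] at h; exact h
  -- the number of extra particles
  have hNB : P - N ≤ 2 * (r * ℓ + r * (ℓ + r)) := by
    rcases Nat.eq_zero_or_pos r with hr0 | hrpos
    · -- `r = 0`: no extra particles
      have : L = ℓ := by rw [hLdef, hr0, add_zero]
      have hPN : P = N := by rw [hP, hN, this]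
      rw [hPN, Nat.sub_self]; exact Nat.zero_le _
    · have hPr : (P : ℝ) ≤ ν * (L : ℝ) ^ 2 := Nat.floor_le (by positivity)
      have hNr : ν * (ℓ : ℝ) ^ 2 < N + 1 := Nat.lt_floor_add_one _
      have hL' : (L : ℝ) = ℓ + r := by rw [hLdef]; push_cast; ring
      have hr1 : (1 : ℝ) ≤ r := by exact_mod_cast hrpos
      have hℓ1' : (1 : ℝ) ≤ ℓ := by exact_mod_cast hℓ1
      have key : (P : ℝ) - N ≤ 2 * ((r : ℝ) * ℓ + r * (ℓ + r)) := by
        have h1 : (P : ℝ) - N ≤ ν * ((L : ℝ) ^ 2 - (ℓ : ℝ) ^ 2) + 1 := by nlinarith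
        have h2 : (L : ℝ) ^ 2 - (ℓ : ℝ) ^ 2 = (r : ℝ) * (L + ℓ) := by rw [hL']; ring
        rw [h2] at h1
        have h3 : ν * ((r : ℝ) * (L + ℓ)) ≤ 5 / 4 * ((r : ℝ) * (L + ℓ)) :=
          mul_le_mul_of_nonneg_right hν (by positivity)
        have h4 : (1 : ℝ) ≤ 3 / 4 * ((r : ℝ) * (L + ℓ)) := by
          have : (2 : ℝ) ≤ (L : ℝ) + ℓ := by rw [hL']; linarith
          nlinarith
        have h5 : (r : ℝ) * ℓ + r * (ℓ + r) = (r : ℝ) * (L + ℓ) := by rw [hL']; ring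
        rw [h5]
        linarith
      have hPN : ((P - N : ℕ) : ℝ) = (P : ℝ) - N := Nat.cast_sub hNP
      have : ((P - N : ℕ) : ℝ) ≤ ((2 * (r * ℓ + r * (ℓ + r)) : ℕ) : ℝ) := by rw [hPN]; push_cast; exact key
      exact_mod_cast this
  have h := hfill ℓ r N (P - N) hN2 hNB
  rw [Nat.add_sub_cancel' hNP] at h
  refine h.trans ?_
  have hgeom : (((r * ℓ + r * (ℓ + r) : ℕ) + (2 * ℓ + r : ℕ) : ℝ)) ≤ (((ℓ + r : ℕ) : ℝ)) * (2 * M + 3) := by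
    push_cast
    have hrM : (r : ℝ) ≤ M := by exact_mod_cast hr.le
    have hr0 : (0 : ℝ) ≤ r := Nat.cast_nonneg r
    have hℓ0 : (0 : ℝ) ≤ ℓ := Nat.cast_nonneg ℓ
    have hM1 : (1 : ℝ) ≤ M := by exact_mod_cast hM
    nlinarith
  have := mul_le_mul_of_nonneg_left hgeom hF
  linarith

/-- **The sector energy density converges** along the full sequence of sides, for every density
`ν ∈ [0, 5/4]`, to `e(ν) = inf_{M ≥ 2} (E M ⌊νM²⌋/M² + (2C+T)/M)`. [folklore] -/
theorem ptb_tendsto_sectorDensity (hc : 0 ≤ c) (hC : 0 ≤ C) (hT : 0 ≤ T) (hF : 0 ≤ F)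
    (hlow : ∀ L K : ℕ, K ≤ 2 * L ^ 2 → -(c * (L : ℝ) ^ 2) ≤ E L K)
    (hup : ∀ L K : ℕ, 2 * (K + 1) ≤ 3 * L ^ 2 → E L (K + 1) ≤ E L K + C)
    (hdn : ∀ L K : ℕ, 1 ≤ K → K ≤ 2 * L ^ 2 → E L (K - 1) ≤ E L K + C)
    (htile : ∀ (M k : ℕ) (Ns : Fin (k + 1) → Fin (k + 1) → ℕ), (∀ i j, Ns i j ≤ 2 * (M * M)) →
      E ((k + 1) * M) (∑ i, ∑ j, Ns i j) ≤ ∑ i, ∑ j, E M (Ns i j) + T * M * k * (k + 1))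
    (hfill : ∀ (ℓ r N NB : ℕ), N ≤ 2 * (ℓ * ℓ) → NB ≤ 2 * (r * ℓ + r * (ℓ + r)) →
      E (ℓ + r) (N + NB) ≤ E ℓ N + F * ((r * ℓ + r * (ℓ + r) : ℕ) + (2 * ℓ + r : ℕ)))
    {ν : ℝ} (hν0 : 0 ≤ ν) (hν : ν ≤ 5 / 4) :
    Tendsto (fun L : ℕ => E L ⌊ν * (L : ℝ) ^ 2⌋₊ / (L : ℝ) ^ 2) atTop
      (𝓝 (sInf ((fun M : ℕ => E M ⌊ν * (M : ℝ) ^ 2⌋₊ / (M : ℝ) ^ 2 + (2 * C + T) / M) '' {M | 2 ≤ M}))) := by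
  have h := ptb_tendsto_density_of_tiling (a := fun L => E L ⌊ν * (L : ℝ) ^ 2⌋₊) (c := c) (A := 2 * C + T)
    (B := F) hc (by positivity) hF (M₀ := 2) one_le_two
    (fun L => hlow L _ (ptb_floor_le_two_mul_sq hν0 hν L))
    (fun m M hm hM => ptb_sectorDensity_tile hC hT hup hdn htile hν0 hν m M hm hM)
    (fun k M r hk hM hr => ptb_sectorDensity_fill hF hfill hν0 hν k M r hk (le_trans one_le_two hM) hr)
  exact h

/-- **`e(0) = 0`**: at density zero every sector energy vanishes. [folklore] -/
theorem ptb_eLim_zero (hC : 0 ≤ C) (hT : 0 ≤ T) (hzero : ∀ L : ℕ, E L 0 = 0) :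
    sInf ((fun M : ℕ => E M ⌊(0 : ℝ) * (M : ℝ) ^ 2⌋₊ / (M : ℝ) ^ 2 + (2 * C + T) / M) '' {M | 2 ≤ M}) = 0 := by
  have hS : ((fun M : ℕ => E M ⌊(0 : ℝ) * (M : ℝ) ^ 2⌋₊ / (M : ℝ) ^ 2 + (2 * C + T) / M) '' {M | 2 ≤ M}) =
      (fun M : ℕ => (2 * C + T) / M) '' {M | 2 ≤ M} := by
    refine Set.image_congr fun M _ => ?_
    simp [hzero]
  rw [hS]
  refine le_antisymm ?_ ?_
  · -- `inf ≤ (2C+T)/M → 0`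
    refine le_of_forall_pos_le_add fun ε hε => ?_
    obtain ⟨M, hM⟩ := exists_nat_gt (max 2 ((2 * C + T) / ε))
    have hM2 : 2 ≤ M := by
      have : (2 : ℝ) < M := lt_of_le_of_lt (le_max_left _ _) hM
      exact_mod_cast this.le
    have hMpos : (0 : ℝ) < M := by exact_mod_cast lt_of_lt_of_le zero_lt_two hM2
    have hbdd : BddBelow ((fun M : ℕ => (2 * C + T) / M) '' {M : ℕ | 2 ≤ M}) :=
      ⟨0, by rintro _ ⟨M', -, rfl⟩; positivity⟩
    have hmem : (2 * C + T) / (M : ℝ) ∈ (fun M : ℕ => (2 * C + T) / M) '' {M : ℕ | 2 ≤ M} := ⟨M, hM2, rfl⟩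
    refine (csInf_le hbdd hmem).trans ?_
    · rw [zero_add, div_le_iff₀ hMpos]
      have : (2 * C + T) / ε < M := lt_of_le_of_lt (le_max_right _ _) hM
      rw [div_lt_iff₀ hε] at this
      linarith
  · exact le_csInf ⟨_, 2, (le_refl 2 : (2 : ℕ) ∈ {M : ℕ | 2 ≤ M}), rfl⟩ (by rintro _ ⟨M, -, rfl⟩; positivity)

/-- **`e` is `C`-Lipschitz on `[0, 5/4]`**: `|e(ν) − e(ν')| ≤ C|ν − ν'|` (the finite-volume two-sided
Lipschitz bound in the particle number passes to the limit). [folklore] -/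
theorem ptb_abs_eLim_sub_le (hc : 0 ≤ c) (hC : 0 ≤ C) (hT : 0 ≤ T) (hF : 0 ≤ F)
    (hlow : ∀ L K : ℕ, K ≤ 2 * L ^ 2 → -(c * (L : ℝ) ^ 2) ≤ E L K)
    (hup : ∀ L K : ℕ, 2 * (K + 1) ≤ 3 * L ^ 2 → E L (K + 1) ≤ E L K + C)
    (hdn : ∀ L K : ℕ, 1 ≤ K → K ≤ 2 * L ^ 2 → E L (K - 1) ≤ E L K + C)
    (htile : ∀ (M k : ℕ) (Ns : Fin (k + 1) → Fin (k + 1) → ℕ), (∀ i j, Ns i j ≤ 2 * (M * M)) →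
      E ((k + 1) * M) (∑ i, ∑ j, Ns i j) ≤ ∑ i, ∑ j, E M (Ns i j) + T * M * k * (k + 1))
    (hfill : ∀ (ℓ r N NB : ℕ), N ≤ 2 * (ℓ * ℓ) → NB ≤ 2 * (r * ℓ + r * (ℓ + r)) →
      E (ℓ + r) (N + NB) ≤ E ℓ N + F * ((r * ℓ + r * (ℓ + r) : ℕ) + (2 * ℓ + r : ℕ)))
    {ν ν' : ℝ} (hν0 : 0 ≤ ν) (hν : ν ≤ 5 / 4) (hν'0 : 0 ≤ ν') (hν' : ν' ≤ 5 / 4) :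
    |sInf ((fun M : ℕ => E M ⌊ν * (M : ℝ) ^ 2⌋₊ / (M : ℝ) ^ 2 + (2 * C + T) / M) '' {M | 2 ≤ M}) -
        sInf ((fun M : ℕ => E M ⌊ν' * (M : ℝ) ^ 2⌋₊ / (M : ℝ) ^ 2 + (2 * C + T) / M) '' {M | 2 ≤ M})| ≤
      C * |ν - ν'| := by
  have h1 := ptb_tendsto_sectorDensity hc hC hT hF hlow hup hdn htile hfill hν0 hν
  have h2 := ptb_tendsto_sectorDensity hc hC hT hF hlow hup hdn htile hfill hν'0 hν'
  -- the finite-volume bound `|a_ν(L) − a_ν'(L)|/L² ≤ C(|ν − ν'| + 1/L²)` for `L ≥ 2`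
  have hfin : ∀ᶠ L : ℕ in atTop, |E L ⌊ν * (L : ℝ) ^ 2⌋₊ / (L : ℝ) ^ 2 - E L ⌊ν' * (L : ℝ) ^ 2⌋₊ / (L : ℝ) ^ 2| ≤
      C * |ν - ν'| + C / (L : ℝ) ^ 2 := by
    filter_upwards [eventually_ge_atTop 2] with L hL
    have hLpos : (0 : ℝ) < (L : ℝ) ^ 2 := by
      have : (0 : ℝ) < L := by exact_mod_cast lt_of_lt_of_le zero_lt_two hL
      positivity
    have hK : 2 * ⌊ν * (L : ℝ) ^ 2⌋₊ ≤ 3 * L ^ 2 := by have := ptb_two_floor_succ_le hν0 hν hL; omega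
    have hK' : 2 * ⌊ν' * (L : ℝ) ^ 2⌋₊ ≤ 3 * L ^ 2 := by have := ptb_two_floor_succ_le hν'0 hν' hL; omega
    have h := ptb_abs_E_sub_E_le hup hdn L _ _ hK hK'
    rw [← sub_div, abs_div, abs_of_pos hLpos, div_le_iff₀ hLpos]
    refine h.trans ?_
    have hfloors : |((⌊ν * (L : ℝ) ^ 2⌋₊ : ℝ)) - ⌊ν' * (L : ℝ) ^ 2⌋₊| ≤ |ν - ν'| * (L : ℝ) ^ 2 + 1 := by
      have a1 : (⌊ν * (L : ℝ) ^ 2⌋₊ : ℝ) ≤ ν * (L : ℝ) ^ 2 := Nat.floor_le (by positivity)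
      have a2 : ν * (L : ℝ) ^ 2 < ⌊ν * (L : ℝ) ^ 2⌋₊ + 1 := Nat.lt_floor_add_one _
      have b1 : (⌊ν' * (L : ℝ) ^ 2⌋₊ : ℝ) ≤ ν' * (L : ℝ) ^ 2 := Nat.floor_le (by positivity)
      have b2 : ν' * (L : ℝ) ^ 2 < ⌊ν' * (L : ℝ) ^ 2⌋₊ + 1 := Nat.lt_floor_add_one _
      rw [abs_le]
      have hνν : |ν - ν'| * (L : ℝ) ^ 2 ≥ (ν - ν') * (L : ℝ) ^ 2 :=
        mul_le_mul_of_nonneg_right (le_abs_self _) hLpos.le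
      have hνν' : |ν - ν'| * (L : ℝ) ^ 2 ≥ (ν' - ν) * (L : ℝ) ^ 2 := by
        have := mul_le_mul_of_nonneg_right (neg_le_abs (ν - ν')) hLpos.le
        linarith
      constructor <;> nlinarith
    have := mul_le_mul_of_nonneg_left hfloors hC
    have e : C * (|ν - ν'| * (L : ℝ) ^ 2 + 1) = (C * |ν - ν'| + C / (L : ℝ) ^ 2) * (L : ℝ) ^ 2 := by
      field_simp
    linarith
  -- pass to the limit
  have hlim := (h1.sub h2).abs
  have hbound : Tendsto (fun L : ℕ => C * |ν - ν'| + C / (L : ℝ) ^ 2) atTop (𝓝 (C * |ν - ν'| + 0)) := by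
    refine tendsto_const_nhds.add ?_
    have : Tendsto (fun L : ℕ => (L : ℝ) ^ 2) atTop atTop := by
      exact (tendsto_natCast_atTop_atTop (R := ℝ)).comp (tendsto_pow_atTop two_ne_zero) |>.congr fun L => by simp
    exact tendsto_const_nhds.div_atTop this
  rw [add_zero] at hbound
  exact le_of_tendsto_of_tendsto hlim hbound hfin

end Abstract

end Summit.HubbardSuperconductivity.HubbardSuperconductivity.Theorems

end
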